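import Summits.RiemannHypothesis.RiemannHypothesis.Theorems.JensenPolynomialsFarGumbelShift

/-!
# Route `JensenPolynomials`, FAR crux `XiWindowZeroFreeRelFar` (B1-rel far) — S3 pointwise input (C), part 1: the DISC SHRINK and
the two comparison bounds for `‖u² + a‖` against `‖υ² + a‖` (RH-FREE; cell rh-jensen, HUMAN RULING D-0040)

For hypothesis (C) `hconn` of eng-4 g3's master assembly `FarGumbel.laplaceFar_of_pointwise` (item `stmt-RiemannHypothesis-19465`,
stub S3 `stub_laplaceFar` of theory g8's line «far-gumbel», WANTED item (L4) `wanted_connector`) the connector point `υ − 2 + it`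
must be compared with a saddle-box point `u_s = x_s + iy_s` through the factor `‖u² + a‖^{M−½}`. Writing
`u² + a = (υ² + a) + (u² − υ²)` (disc `‖a‖ ≤ (9/25)υ²`):

* `norm_sub_le_shrink` — DISC SHRINK: `‖v − r‖ ≤ (1 − 25r/34)·‖v‖` for `‖v − 1‖ ≤ 9/25`, `0 ≤ r ≤ 1/2` (equality along
  `v = 34/25`; `25/34` is the least `Re(1/v)` on the disc), and its scaled form `norm_sub_le_shrink_scaled`;
* `norm_connector_sq_add_le` — `‖(υ−2+it)² + a‖ ≤ (1 − 47/(20υ))·‖υ² + a‖` (`υ ≥ 189/20`, `|t| ≤ 1/10`);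
* `norm_saddle_sq_add_ge` — `‖(x_s+iy_s)² + a‖ ≥ (1 − 4/(5υ))·‖υ² + a‖` (`|x_s − υ| ≤ 3/20`, `|y_s| ≤ 1/10`).

Part 2 (`JensenPolynomialsFarGumbelConnector.lean`) raises the ratio to the power `M − ½ = 2Λυ − (9υ+1)/2`.
WHAT THIS IS NOT: elementary plane geometry; nothing here bears on the zeros of `ζ` or the truth of RH.
Landed `--supports stmt-RiemannHypothesis-19465 --as helper` by prover-rh-jensen-prover-g5-0.
-/

noncomputable section
-- D-0017: `Summit.RiemannHypothesis.RiemannHypothesis.…` duplicates the namespace BY DESIGN (single-problem summit).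
set_option linter.dupNamespace false

namespace Summit.RiemannHypothesis.RiemannHypothesis.Theorems.JensenPolynomials.FarGumbel

open Literature.NumberTheory.LFunctions MeasureTheory Set Filter Complex
open Summit.RiemannHypothesis.RiemannHypothesis.Theorems.JensenPolynomials.WindowEGF
open scoped Real

/-! ## 1. The disc shrink -/

/-- **Disc shrink (unit form).** For `‖v − 1‖ ≤ 9/25` and `0 ≤ r ≤ 1/2`: `‖v − r‖ ≤ (1 − 25r/34)·‖v‖`
(equality along the real point `v = 34/25`; `25/34 = 1/(1 + 9/25)` is the least value of `Re(1/v)` on the disc). -/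
theorem norm_sub_le_shrink {v : ℂ} (hv : ‖v - 1‖ ≤ 9 / 25) {r : ℝ} (hr0 : 0 ≤ r) (hr1 : r ≤ 1 / 2) :
    ‖v - r‖ ≤ (1 - 25 / 34 * r) * ‖v‖ := by
  have hk : 0 ≤ 1 - 25 / 34 * r := by linarith
  have e1 : ‖v - r‖ ^ 2 = (v.re - r) ^ 2 + v.im ^ 2 := by
    rw [Complex.sq_norm, Complex.normSq_apply]; simp; ring
  have e2 : ‖v‖ ^ 2 = v.re ^ 2 + v.im ^ 2 := by
    rw [Complex.sq_norm, Complex.normSq_apply]; ring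
  have e3 : ‖v - 1‖ ^ 2 = (v.re - 1) ^ 2 + v.im ^ 2 := by
    rw [Complex.sq_norm, Complex.normSq_apply]; simp; ring
  have hdisc : (v.re - 1) ^ 2 + v.im ^ 2 ≤ (9 / 25) ^ 2 := by
    rw [← e3]; exact pow_le_pow_left₀ (norm_nonneg _) hv 2
  set p := v.re with hp
  set q := v.im with hq
  have hα : p - 1 ≤ 9 / 25 := by
    have h1 : (p - 1) ^ 2 ≤ (9 / 25) ^ 2 := by nlinarith [sq_nonneg q]
    exact (abs_le.mp (abs_le_of_sq_le_sq h1 (by norm_num))).2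
  have hA : 0 ≤ 9 - 16 * (p - 1) - 25 * ((p - 1) ^ 2 + q ^ 2) := by nlinarith
  have hB : 0 ≤ 81 / 625 - ((p - 1) ^ 2 + q ^ 2) := by nlinarith
  have hl : 0 ≤ 1 - 625 / 544 * r := by linarith
  have key : (1 - 25 / 34 * r) ^ 2 * (p ^ 2 + q ^ 2) - ((p - r) ^ 2 + q ^ 2) =
      r * ((1 - 625 / 544 * r) * ((9 - 16 * (p - 1) - 25 * ((p - 1) ^ 2 + q ^ 2)) / 17) +
        (625 / 544 * r) * (81 / 625 - ((p - 1) ^ 2 + q ^ 2))) := by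
    ring
  have hnn : 0 ≤ r * ((1 - 625 / 544 * r) * ((9 - 16 * (p - 1) - 25 * ((p - 1) ^ 2 + q ^ 2)) / 17) +
        (625 / 544 * r) * (81 / 625 - ((p - 1) ^ 2 + q ^ 2))) := by
    apply mul_nonneg hr0
    apply add_nonneg
    · exact mul_nonneg hl (div_nonneg hA (by norm_num))
    · exact mul_nonneg (by positivity) hB
  have hsq : ‖v - r‖ ^ 2 ≤ ((1 - 25 / 34 * r) * ‖v‖) ^ 2 := by
    rw [e1, mul_pow, e2]; linarith [key, hnn]
  exact le_of_pow_le_pow_left₀ two_ne_zero (mul_nonneg hk (norm_nonneg v)) hsq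

/-- **Disc shrink (scaled).** For `‖v − υ²‖ ≤ (9/25)υ²` and `0 ≤ R ≤ υ²/2`: `‖v − R‖ ≤ (1 − 25R/(34υ²))·‖v‖`. -/
theorem norm_sub_le_shrink_scaled {υ : ℝ} (hυ : 0 < υ) {v : ℂ} (hv : ‖v - (υ : ℂ) ^ 2‖ ≤ 9 / 25 * υ ^ 2)
    {R : ℝ} (hR0 : 0 ≤ R) (hR1 : R ≤ υ ^ 2 / 2) :
    ‖v - R‖ ≤ (1 - 25 / 34 * (R / υ ^ 2)) * ‖v‖ := by
  have hυ2 : 0 < υ ^ 2 := by positivity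
  set c : ℂ := (υ : ℂ) ^ 2 with hc
  have hcn : ‖c‖ = υ ^ 2 := by rw [hc, norm_pow, Complex.norm_real, Real.norm_of_nonneg hυ.le]
  have hc0 : c ≠ 0 := by
    intro h; rw [h, norm_zero] at hcn; linarith
  have h1 : ‖v / c - 1‖ ≤ 9 / 25 := by
    rw [show v / c - 1 = (v - c) / c by field_simp, norm_div, hcn, div_le_iff₀ hυ2]
    exact hv
  have h2 := norm_sub_le_shrink h1 (r := R / υ ^ 2) (by positivity)
    (by rw [div_le_iff₀ hυ2]; linarith)
  have e1 : v / c - ((R / υ ^ 2 : ℝ) : ℂ) = (v - R) / c := by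
    rw [hc]; push_cast; field_simp
  rw [e1, norm_div, norm_div, hcn, div_le_iff₀ hυ2] at h2
  calc ‖v - R‖ ≤ (1 - 25 / 34 * (R / υ ^ 2)) * (‖v‖ / υ ^ 2) * υ ^ 2 := h2
    _ = (1 - 25 / 34 * (R / υ ^ 2)) * ‖v‖ := by field_simp

/-! ## 2. The two comparison bounds against `‖υ² + a‖` -/

/-- `‖υ² + a‖ ≥ (16/25)υ²` on the disc `‖a‖ ≤ (9/25)υ²`. -/
theorem norm_sq_add_ge {υ : ℝ} {a : ℂ} (ha : ‖a‖ ≤ (9 / 25 : ℝ) * υ ^ 2) :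
    (16 / 25 : ℝ) * υ ^ 2 ≤ ‖(υ : ℂ) ^ 2 + a‖ := by
  have h1 : ‖(υ : ℂ) ^ 2‖ = υ ^ 2 := by
    rw [norm_pow, Complex.norm_real, Real.norm_eq_abs, sq_abs]
  have h2 : ‖(υ : ℂ) ^ 2‖ - ‖a‖ ≤ ‖(υ : ℂ) ^ 2 + a‖ := by
    have := norm_sub_norm_le ((υ : ℂ) ^ 2) (-a)
    rwa [sub_neg_eq_add, norm_neg] at this
  linarith

/-- **The connector point is deep inside**: `‖(υ−2+it)² + a‖ ≤ (1 − 47/(20υ))·‖υ² + a‖` (`υ ≥ 189/20`, `|t| ≤ 1/10`,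
`‖a‖ ≤ (9/25)υ²`). -/
theorem norm_connector_sq_add_le {υ : ℝ} (hυ : (189 / 20 : ℝ) ≤ υ) {a : ℂ} (ha : ‖a‖ ≤ (9 / 25 : ℝ) * υ ^ 2)
    {t : ℝ} (ht : |t| ≤ 1 / 10) :
    ‖((((υ - 2 : ℝ)) : ℂ) + t * I) ^ 2 + a‖ ≤ (1 - 47 / 20 / υ) * ‖(υ : ℂ) ^ 2 + a‖ := by
  have hυpos : 0 < υ := by linarith
  have hυ2 : 0 < υ ^ 2 := by positivity
  obtain ⟨ht1, ht2⟩ := abs_le.mp ht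
  set v : ℂ := (υ : ℂ) ^ 2 + a with hv
  set R : ℝ := 4 * υ - 4 + t ^ 2 with hR
  have hva : ‖v - (υ : ℂ) ^ 2‖ ≤ 9 / 25 * υ ^ 2 := by
    rw [hv, add_sub_cancel_left]; exact ha
  have hV := norm_sq_add_ge (υ := υ) ha
  rw [← hv] at hV
  -- decomposition `(υ−2+it)² + a = (v − R) + 2(υ−2)t·i`
  have hdec : ((((υ - 2 : ℝ)) : ℂ) + t * I) ^ 2 + a = (v - R) + ((2 * (υ - 2) * t : ℝ) : ℂ) * I := by
    rw [hv, hR]; push_cast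
    ring_nf; rw [I_sq]; ring
  have hR0 : 0 ≤ R := by rw [hR]; nlinarith
  have hR1 : R ≤ υ ^ 2 / 2 := by rw [hR]; nlinarith
  have hshrink := norm_sub_le_shrink_scaled hυpos hva hR0 hR1
  have himag : ‖((2 * (υ - 2) * t : ℝ) : ℂ) * I‖ ≤ 1 / 5 * (υ - 2) := by
    rw [norm_mul, Complex.norm_I, mul_one, Complex.norm_real, Real.norm_eq_abs, abs_mul,
      abs_of_nonneg (by linarith : (0 : ℝ) ≤ 2 * (υ - 2))]
    have : |t| ≤ 1 / 10 := ht
    nlinarith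
  have hRlo : 4 * υ - 4 ≤ R := by rw [hR]; nlinarith
  calc ‖((((υ - 2 : ℝ)) : ℂ) + t * I) ^ 2 + a‖ = ‖(v - R) + ((2 * (υ - 2) * t : ℝ) : ℂ) * I‖ := by rw [hdec]
    _ ≤ ‖v - R‖ + ‖((2 * (υ - 2) * t : ℝ) : ℂ) * I‖ := norm_add_le _ _
    _ ≤ (1 - 25 / 34 * (R / υ ^ 2)) * ‖v‖ + 1 / 5 * (υ - 2) := add_le_add hshrink himag
    _ ≤ (1 - 25 / 34 * ((4 * υ - 4) / υ ^ 2)) * ‖v‖ + 1 / 5 * (υ - 2) * (‖v‖ / (16 / 25 * υ ^ 2)) := by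
        have h1 : (1 - 25 / 34 * (R / υ ^ 2)) * ‖v‖ ≤ (1 - 25 / 34 * ((4 * υ - 4) / υ ^ 2)) * ‖v‖ := by
          apply mul_le_mul_of_nonneg_right _ (norm_nonneg _)
          have : (4 * υ - 4) / υ ^ 2 ≤ R / υ ^ 2 := div_le_div_of_nonneg_right hRlo hυ2.le
          linarith
        have h2 : 1 / 5 * (υ - 2) ≤ 1 / 5 * (υ - 2) * (‖v‖ / (16 / 25 * υ ^ 2)) := by
          have : 1 ≤ ‖v‖ / (16 / 25 * υ ^ 2) := by rw [le_div_iff₀ (by positivity)]; linarith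
          have h0 : 0 ≤ 1 / 5 * (υ - 2) := by linarith
          nlinarith
        linarith
    _ = (1 - (25 / 34 * (4 * υ - 4) - 5 / 16 * (υ - 2)) / υ ^ 2) * ‖v‖ := by
        field_simp
        ring
    _ ≤ (1 - 47 / 20 / υ) * ‖v‖ := by
        apply mul_le_mul_of_nonneg_right _ (norm_nonneg _)
        have : 47 / 20 / υ ≤ (25 / 34 * (4 * υ - 4) - 5 / 16 * (υ - 2)) / υ ^ 2 := by
          rw [div_le_div_iff₀ hυpos hυ2]
          nlinarith
        linarith

/-- **The saddle box is shallow**: `‖(x_s+iy_s)² + a‖ ≥ (1 − 4/(5υ))·‖υ² + a‖` for `|x_s − υ| ≤ 3/20`, `|y_s| ≤ 1/10`. -/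
theorem norm_saddle_sq_add_ge {υ : ℝ} (hυ : (189 / 20 : ℝ) ≤ υ) {a : ℂ} (ha : ‖a‖ ≤ (9 / 25 : ℝ) * υ ^ 2)
    {x y : ℝ} (hx : |x - υ| ≤ 3 / 20) (hy : |y| ≤ 1 / 10) :
    (1 - 4 / 5 / υ) * ‖(υ : ℂ) ^ 2 + a‖ ≤ ‖((x : ℂ) + y * I) ^ 2 + a‖ := by
  have hυpos : 0 < υ := by linarith
  obtain ⟨hx1, hx2⟩ := abs_le.mp hx
  obtain ⟨hy1, hy2⟩ := abs_le.mp hy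
  set v : ℂ := (υ : ℂ) ^ 2 + a with hv
  have hV := norm_sq_add_ge (υ := υ) ha
  rw [← hv] at hV
  have hdec : ((x : ℂ) + y * I) ^ 2 + a = v + ((((x ^ 2 - y ^ 2 - υ ^ 2 : ℝ)) : ℂ) + ((2 * x * y : ℝ) : ℂ) * I) := by
    rw [hv]; push_cast
    ring_nf; rw [I_sq]; ring
  have hdiff : ‖(((x ^ 2 - y ^ 2 - υ ^ 2 : ℝ)) : ℂ) + ((2 * x * y : ℝ) : ℂ) * I‖ ≤ 4 / 5 / υ * ‖v‖ := by
    have h1 : ‖(((x ^ 2 - y ^ 2 - υ ^ 2 : ℝ)) : ℂ) + ((2 * x * y : ℝ) : ℂ) * I‖ ≤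
        |x ^ 2 - y ^ 2 - υ ^ 2| + |2 * x * y| := by
      calc _ ≤ ‖(((x ^ 2 - y ^ 2 - υ ^ 2 : ℝ)) : ℂ)‖ + ‖((2 * x * y : ℝ) : ℂ) * I‖ := norm_add_le _ _
        _ = |x ^ 2 - y ^ 2 - υ ^ 2| + |2 * x * y| := by
            rw [norm_mul, Complex.norm_I, mul_one, Complex.norm_real, Complex.norm_real, Real.norm_eq_abs,
              Real.norm_eq_abs]
    have h2 : |x ^ 2 - y ^ 2 - υ ^ 2| ≤ 3 / 10 * υ + 7 / 200 := by
      rw [abs_le]; constructor <;> nlinarith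
    have h3 : |2 * x * y| ≤ 1 / 5 * υ + 3 / 100 := by
      rw [abs_mul, abs_of_nonneg (by linarith : (0 : ℝ) ≤ 2 * x)]
      have hx0 : (0 : ℝ) ≤ 2 * x := by linarith
      have := mul_le_mul_of_nonneg_left hy hx0
      linarith
    have h4 : 3 / 10 * υ + 7 / 200 + (1 / 5 * υ + 3 / 100) ≤ 4 / 5 / υ * (16 / 25 * υ ^ 2) := by
      rw [show 4 / 5 / υ * (16 / 25 * υ ^ 2) = 64 / 125 * υ by field_simp; ring]
      linarith
    have h5 : 4 / 5 / υ * (16 / 25 * υ ^ 2) ≤ 4 / 5 / υ * ‖v‖ :=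
      mul_le_mul_of_nonneg_left hV (by positivity)
    linarith
  calc (1 - 4 / 5 / υ) * ‖v‖ = ‖v‖ - 4 / 5 / υ * ‖v‖ := by ring
    _ ≤ ‖v‖ - ‖(((x ^ 2 - y ^ 2 - υ ^ 2 : ℝ)) : ℂ) + ((2 * x * y : ℝ) : ℂ) * I‖ := by linarith
    _ ≤ ‖v + ((((x ^ 2 - y ^ 2 - υ ^ 2 : ℝ)) : ℂ) + ((2 * x * y : ℝ) : ℂ) * I)‖ := norm_sub_le_norm_add _ _
    _ = ‖((x : ℂ) + y * I) ^ 2 + a‖ := by rw [hdec]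

end Summit.RiemannHypothesis.RiemannHypothesis.Theorems.JensenPolynomials.FarGumbel

end
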